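import Summits.BirchSwinnertonDyer.BirchSwinnertonDyer.Theorems.GenusKolyvaginAtTwoTorsionCellSELNegTwistKernel
import HarnessLib

/-!
# SEL (iso-class Selmer pair law), C1-M: bit data of the torsion pairs and of the twisting factor for `E^{(−p₀M)}`

Crux R″ `RankOneTwoTorsionResidualAtTwo` (stmt-27478), LINE 49 «full_vertex», SUPPORT stub SEL
`IsoClassSelmerPairLawAtTwo`, the `C₁` half (LEAD memo `Cruxes/…/Lines/torsion_cell_full_vertex_SEL_C1_road_g36.md`,
§3: the torsion bits `η(τ), ρ(τ), s(τ)` of the unified system).  Setting: `E/ℚ` with rational `2`-torsion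
`e₁ < e₂ < e₃`, root differences units off `S`, `Q` a set of full-admissible primes `≡ 3 (mod 4)` with common bit `ε`,
and a prime `p₀` at which the three positive root differences are squares.

* `exists_torsionUnits` — for every `(τ₁, τ₂) ∈ 𝔽₂²` the torsion pair `κ_τ = τ₁T₁ + τ₂T₂` has explicit unit components
  `(t₁, t₂) ∈ {(1,1), (δ₁, e₁−e₂), (e₂−e₁, δ₂), (e₃−e₁, e₃−e₂)}` with: `c_E(t₁,t₂) ∈ Sel⁽²⁾(E)`, even valuations off `S`,
  residues `(τ₁+ετ₂, (1+ε)τ₁+τ₂)` at every `q ∈ Q`, residues `(0, τ₁+τ₂)` at `p₀`, signs `(0, τ₁+τ₂)`.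
* `exists_twistUnit` — for `γ ∈ 𝔽₂` the unit `X(γ) = (−p₀)^γ`: parity `γ` at `p₀`, `0` elsewhere, residue `γ[−p₀/j]` at
  `j ∈ Q`, residue `γ` at `p₀`, sign `γ`.

Everything is proved; no LINE 49 statement is restated; BSD is not advanced by this file alone.

## References

* [SilvermanAEC2009] J. H. Silverman, *The Arithmetic of Elliptic Curves*, 2nd ed., Prop. X.1.4, Thm. X.4.2.
* [Kane2013SelmerTwists] D. M. Kane, Algebra Number Theory 7 (2013), §2.
-/

noncomputable section

open scoped Classical

namespace Summit.BirchSwinnertonDyer.BirchSwinnertonDyer.Theorems.GenusKolyvaginAtTwo.TorsionCellSEL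

open WeierstrassCurve WeierstrassCurve.Affine WeierstrassCurve.Affine.Point
open Literature.NumberTheory.GaloisRepresentations Literature.NumberTheory.EllipticCurves Field
open Literature.NumberTheory.EllipticCurves.TwoDescentLocal
open Literature.NumberTheory.EllipticCurves.KramerTwoDescent
open Summit.BirchSwinnertonDyer.BirchSwinnertonDyer.Theorems.GenusKolyvaginAtTwo.TorsionCellD0
open IsDedekindDomain NumberField Rat.HeightOneSpectrum

variable (E : WeierstrassCurve ℚ) [E.IsElliptic] {e₁ e₂ e₃ : ℚ} (S Q : Finset ℕ) {p₀ : ℕ} [hp₀ : Fact p₀.Prime]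

/-- `𝔽₂` helper: `1 + ε + x = 1 ⟹ x = ε`. [folklore] -/
private theorem zmod2_solveA (ε x : ZMod 2) (h : 1 + ε + x = 1) : x = ε := by revert ε x; decide

/-- `𝔽₂` helper: `ε + x = 1 ⟹ x = 1 + ε`. [folklore] -/
private theorem zmod2_solveB (ε x : ZMod 2) (h : ε + x = 1) : x = 1 + ε := by revert ε x; decide

/-- `𝔽₂` helper: `1 + (1 + ε) = ε`. [folklore] -/
private theorem zmod2_solveC (ε : ZMod 2) : 1 + (1 + ε) = ε := by revert ε; decide

/-- `𝔽₂` helper: `(1 + ε)·1 + 1 = ε`. [folklore] -/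
private theorem zmod2_solveD (ε : ZMod 2) : (1 + ε) * 1 + 1 = ε := by revert ε; decide

/-- **THE TORSION PAIRS AND THEIR BITS** (see the module docstring).
[cite: SilvermanAEC2009, Prop. X.1.4, Thm. X.4.2] [cite: Kane2013SelmerTwists, §2] -/
theorem exists_torsionUnits (h : E.toAffine.SplitTwoTorsion e₁ e₂ e₃) (h12 : e₁ < e₂) (h23 : e₂ < e₃)
    (hgood : ∀ ℓ : ℕ, (hℓ : ℓ.Prime) → ℓ ∉ S → haveI : Fact ℓ.Prime := ⟨hℓ⟩;
      padicValRat ℓ (e₁ - e₂) = 0 ∧ padicValRat ℓ (e₁ - e₃) = 0 ∧ padicValRat ℓ (e₂ - e₃) = 0)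
    (hQ4 : ∀ q ∈ Q, q % 4 = 3)
    (hadm : ∀ q ∈ Q, (hq : q.Prime) → haveI : Fact q.Prime := ⟨hq⟩;
      qrBit q ((e₁ - e₂) * (e₁ - e₃)) = 1 ∧ qrBit q ((e₂ - e₁) * (e₂ - e₃)) = 1)
    {ε : ZMod 2} (hε : ∀ q ∈ Q, (hq : q.Prime) → haveI : Fact q.Prime := ⟨hq⟩; qrBit q (e₂ - e₁) = ε)
    (hp₀4 : p₀ % 4 = 3) (hres₀ : qrBit p₀ (e₂ - e₁) = 0 ∧ qrBit p₀ (e₃ - e₁) = 0 ∧ qrBit p₀ (e₃ - e₂) = 0)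
    (τ₁ τ₂ : ZMod 2) :
    ∃ t₁ t₂ : ℚˣ,
      ((τ₁ = 0 ∧ τ₂ = 0 ∧ (t₁ : ℚ) = 1 ∧ (t₂ : ℚ) = 1) ∨
        (τ₁ = 1 ∧ τ₂ = 0 ∧ (t₁ : ℚ) = (e₁ - e₂) * (e₁ - e₃) ∧ (t₂ : ℚ) = e₁ - e₂) ∨
        (τ₁ = 0 ∧ τ₂ = 1 ∧ (t₁ : ℚ) = e₂ - e₁ ∧ (t₂ : ℚ) = (e₂ - e₁) * (e₂ - e₃)) ∨
        (τ₁ = 1 ∧ τ₂ = 1 ∧ (t₁ : ℚ) = e₃ - e₁ ∧ (t₂ : ℚ) = e₃ - e₂)) ∧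
      E.twoDescentClass h t₁ t₂ ∈ E.selmerGroup 2 ∧
      (∀ ℓ : ℕ, (hℓ : ℓ.Prime) → ℓ ∉ S → haveI : Fact ℓ.Prime := ⟨hℓ⟩;
        parityBit ℓ (t₁ : ℚ) = 0 ∧ parityBit ℓ (t₂ : ℚ) = 0) ∧
      (∀ j ∈ Q, (hj : j.Prime) → haveI : Fact j.Prime := ⟨hj⟩;
        qrBit j (t₁ : ℚ) = τ₁ + ε * τ₂ ∧ qrBit j (t₂ : ℚ) = (1 + ε) * τ₁ + τ₂) ∧
      qrBit p₀ (t₁ : ℚ) = 0 ∧ qrBit p₀ (t₂ : ℚ) = τ₁ + τ₂ ∧ signBit (t₁ : ℚ) = 0 ∧ signBit (t₂ : ℚ) = τ₁ + τ₂ := by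
  have he12 : e₁ - e₂ ≠ 0 := sub_ne_zero.mpr h.ne₁₂
  have he21 : e₂ - e₁ ≠ 0 := sub_ne_zero.mpr h.ne₁₂.symm
  have he13 : e₁ - e₃ ≠ 0 := sub_ne_zero.mpr h.ne₁₃
  have he31 : e₃ - e₁ ≠ 0 := sub_ne_zero.mpr h.ne₁₃.symm
  have he23 : e₂ - e₃ ≠ 0 := sub_ne_zero.mpr h.ne₂₃
  have he32 : e₃ - e₂ ≠ 0 := sub_ne_zero.mpr h.ne₂₃.symm
  -- parities off `S`
  have hpar : ∀ ℓ : ℕ, (hℓ : ℓ.Prime) → ℓ ∉ S → haveI : Fact ℓ.Prime := ⟨hℓ⟩;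
      parityBit ℓ ((e₁ - e₂) * (e₁ - e₃)) = 0 ∧ parityBit ℓ (e₁ - e₂) = 0 ∧ parityBit ℓ (e₂ - e₁) = 0 ∧
        parityBit ℓ ((e₂ - e₁) * (e₂ - e₃)) = 0 ∧ parityBit ℓ (e₃ - e₁) = 0 ∧ parityBit ℓ (e₃ - e₂) = 0 := by
    intro ℓ hℓ hℓS
    haveI : Fact ℓ.Prime := ⟨hℓ⟩
    obtain ⟨g12, g13, g23⟩ := hgood ℓ hℓ hℓS
    have g21 : padicValRat ℓ (e₂ - e₁) = 0 := by rw [← neg_sub, padicValRat.neg, g12]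
    have g31 : padicValRat ℓ (e₃ - e₁) = 0 := by rw [← neg_sub, padicValRat.neg, g13]
    have g32 : padicValRat ℓ (e₃ - e₂) = 0 := by rw [← neg_sub, padicValRat.neg, g23]
    refine ⟨?_, ?_, ?_, ?_, ?_, ?_⟩
    · rw [parityBit_mul he12 he13]; simp [parityBit, g12, g13]
    · simp [parityBit, g12]
    · simp [parityBit, g21]
    · rw [parityBit_mul he21 he23]; simp [parityBit, g21, g23]
    · simp [parityBit, g31]
    · simp [parityBit, g32]
  -- residues at the primes of `Q`
  have hres : ∀ j ∈ Q, (hj : j.Prime) → haveI : Fact j.Prime := ⟨hj⟩;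
      qrBit j ((e₁ - e₂) * (e₁ - e₃)) = 1 ∧ qrBit j (e₁ - e₂) = 1 + ε ∧ qrBit j (e₂ - e₁) = ε ∧
        qrBit j ((e₂ - e₁) * (e₂ - e₃)) = 1 ∧ qrBit j (e₃ - e₁) = 1 + ε ∧ qrBit j (e₃ - e₂) = ε := by
    intro j hj hjp
    haveI : Fact j.Prime := ⟨hjp⟩
    obtain ⟨hδ₁, hδ₂⟩ := hadm j hj hjp
    have hεj := hε j hj hjp
    have hm1 : qrBit j (-1 : ℚ) = 1 := qrBit_neg_one_eq_one_of_emod_four (hQ4 j hj)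
    have hq12 : qrBit j (e₁ - e₂) = 1 + ε := by rw [← neg_sub, qrBit_neg (p := j) he21, hm1, hεj]
    have hq13 : qrBit j (e₁ - e₃) = ε := by
      have := hδ₁; rw [qrBit_mul j he12 he13, hq12] at this; exact zmod2_solveA ε _ this
    have hq31 : qrBit j (e₃ - e₁) = 1 + ε := by rw [← neg_sub, qrBit_neg (p := j) he13, hm1, hq13]
    have hq23 : qrBit j (e₂ - e₃) = 1 + ε := by
      have := hδ₂; rw [qrBit_mul j he21 he23, hεj] at this; exact zmod2_solveB ε _ this
    have hq32 : qrBit j (e₃ - e₂) = ε := by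
      rw [← neg_sub, qrBit_neg (p := j) he23, hm1, hq23, zmod2_solveC]
    exact ⟨hδ₁, hq12, hεj, hδ₂, hq31, hq32⟩
  -- residues at `p₀`
  obtain ⟨r21, r31, r32⟩ := hres₀
  have hm1p : qrBit p₀ (-1 : ℚ) = 1 := qrBit_neg_one_eq_one_of_emod_four hp₀4
  have r12 : qrBit p₀ (e₁ - e₂) = 1 := by rw [← neg_sub, qrBit_neg (p := p₀) he21, hm1p, r21, add_zero]
  have r13 : qrBit p₀ (e₁ - e₃) = 1 := by rw [← neg_sub, qrBit_neg (p := p₀) he31, hm1p, r31, add_zero]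
  have r23 : qrBit p₀ (e₂ - e₃) = 1 := by rw [← neg_sub, qrBit_neg (p := p₀) he32, hm1p, r32, add_zero]
  have rD₁ : qrBit p₀ ((e₁ - e₂) * (e₁ - e₃)) = 0 := by rw [qrBit_mul p₀ he12 he13, r12, r13]; decide
  have rD₂ : qrBit p₀ ((e₂ - e₁) * (e₂ - e₃)) = 1 := by rw [qrBit_mul p₀ he21 he23, r21, r23, zero_add]
  -- signs
  have sD₁ : signBit ((e₁ - e₂) * (e₁ - e₃)) = 0 :=
    (signBit_eq_zero_iff (mul_ne_zero he12 he13)).mpr (mul_pos_of_neg_of_neg (sub_neg.mpr h12) (sub_neg.mpr (h12.trans h23)))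
  have sD₂ : signBit ((e₂ - e₁) * (e₂ - e₃)) = 1 := by
    unfold signBit; rw [if_pos (mul_neg_of_pos_of_neg (sub_pos.mpr h12) (sub_neg.mpr h23))]
  have s12 : signBit (e₁ - e₂) = 1 := by unfold signBit; rw [if_pos (sub_neg.mpr h12)]
  have s21 : signBit (e₂ - e₁) = 0 := (signBit_eq_zero_iff he21).mpr (sub_pos.mpr h12)
  have s31 : signBit (e₃ - e₁) = 0 := (signBit_eq_zero_iff he31).mpr (sub_pos.mpr (h12.trans h23))
  have s32 : signBit (e₃ - e₂) = 0 := (signBit_eq_zero_iff he32).mpr (sub_pos.mpr h23)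
  -- the four Selmer torsion pairs
  have hO : E.twoDescentClass h 1 1 ∈ E.selmerGroup 2 := by
    rw [← E.eq_twoDescentClass_of_kummerEquiv_eq h 1 1 (c := 0)
      (by rw [_root_.map_zero, _root_.map_zero, QuotientGroup.mk_one, ofMul_one])
      (by rw [_root_.map_zero, _root_.map_zero, QuotientGroup.mk_one, ofMul_one])]
    exact zero_mem _
  have hT₁ : E.twoDescentClass h (Units.mk0 _ (mul_ne_zero he12 he13)) (Units.mk0 _ he12) ∈ E.selmerGroup 2 :=
    twoDescentClass_mem_selmerGroup_T₁ E h _ _ rfl rfl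
  have hT₂ : E.twoDescentClass h (Units.mk0 _ he21) (Units.mk0 _ (mul_ne_zero he21 he23)) ∈ E.selmerGroup 2 :=
    twoDescentClass_mem_selmerGroup_T₂ E h _ _ rfl rfl
  have hT₃ : E.twoDescentClass h (Units.mk0 _ he31) (Units.mk0 _ he32) ∈ E.selmerGroup 2 :=
    twoDescentClass_mem_selmerGroup_T₃ E h _ _ rfl rfl
  have hz2 : ∀ x : ZMod 2, x = 0 ∨ x = 1 := by decide
  rcases hz2 τ₁ with e1 | e1 <;> rcases hz2 τ₂ with e2 | e2 <;> subst e1 <;> subst e2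
  · -- `(0,0)`: `O`
    refine ⟨1, 1, Or.inl ⟨rfl, rfl, rfl, rfl⟩, hO, fun ℓ hℓ hℓS => by simp [parityBit], fun j hj hjp => ?_, ?_, ?_, ?_, ?_⟩
    · haveI : Fact j.Prime := ⟨hjp⟩
      rw [Units.val_one, qrBit_one]; constructor <;> ring
    · rw [Units.val_one, qrBit_one]
    · rw [Units.val_one, qrBit_one]; ring
    · rw [Units.val_one]; exact (signBit_eq_zero_iff one_ne_zero).mpr one_pos
    · rw [Units.val_one, (signBit_eq_zero_iff one_ne_zero).mpr one_pos]; ring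
  · -- `(0,1)`: `T₂`
    refine ⟨Units.mk0 _ he21, Units.mk0 _ (mul_ne_zero he21 he23), Or.inr (Or.inr (Or.inl ⟨rfl, rfl, rfl, rfl⟩)), hT₂,
      fun ℓ hℓ hℓS => ?_, fun j hj hjp => ?_, ?_, ?_, ?_, ?_⟩
    · obtain ⟨-, -, p3, p4, -, -⟩ := hpar ℓ hℓ hℓS; rw [Units.val_mk0, Units.val_mk0]; exact ⟨p3, p4⟩
    · haveI : Fact j.Prime := ⟨hjp⟩
      obtain ⟨-, -, q3, q4, -, -⟩ := hres j hj hjp; rw [Units.val_mk0, Units.val_mk0, q3, q4]; constructor <;> ring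
    · rw [Units.val_mk0, r21]
    · rw [Units.val_mk0, rD₂]; ring
    · rw [Units.val_mk0, s21]
    · rw [Units.val_mk0, sD₂]; ring
  · -- `(1,0)`: `T₁`
    refine ⟨Units.mk0 _ (mul_ne_zero he12 he13), Units.mk0 _ he12, Or.inr (Or.inl ⟨rfl, rfl, rfl, rfl⟩), hT₁,
      fun ℓ hℓ hℓS => ?_, fun j hj hjp => ?_, ?_, ?_, ?_, ?_⟩
    · obtain ⟨p1, p2, -, -, -, -⟩ := hpar ℓ hℓ hℓS; rw [Units.val_mk0, Units.val_mk0]; exact ⟨p1, p2⟩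
    · haveI : Fact j.Prime := ⟨hjp⟩
      obtain ⟨q1, q2, -, -, -, -⟩ := hres j hj hjp; rw [Units.val_mk0, Units.val_mk0, q1, q2]; constructor <;> ring
    · rw [Units.val_mk0, rD₁]
    · rw [Units.val_mk0, r12]; ring
    · rw [Units.val_mk0, sD₁]
    · rw [Units.val_mk0, s12]; ring
  · -- `(1,1)`: `T₃`
    refine ⟨Units.mk0 _ he31, Units.mk0 _ he32, Or.inr (Or.inr (Or.inr ⟨rfl, rfl, rfl, rfl⟩)), hT₃,
      fun ℓ hℓ hℓS => ?_, fun j hj hjp => ?_, ?_, ?_, ?_, ?_⟩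
    · obtain ⟨-, -, -, -, p5, p6⟩ := hpar ℓ hℓ hℓS; rw [Units.val_mk0, Units.val_mk0]; exact ⟨p5, p6⟩
    · haveI : Fact j.Prime := ⟨hjp⟩
      obtain ⟨-, -, -, -, q5, q6⟩ := hres j hj hjp; rw [Units.val_mk0, Units.val_mk0, q5, q6, zmod2_solveD]
      exact ⟨by ring, rfl⟩
    · rw [Units.val_mk0, r31]
    · rw [Units.val_mk0, r32]; decide
    · rw [Units.val_mk0, s31]
    · rw [Units.val_mk0, s32]; decide

/-- **THE TWISTING FACTOR `X(γ) = (−p₀)^γ` AND ITS BITS.** [cite: SilvermanAEC2009, Prop. X.1.4] -/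
theorem exists_twistUnit (hp₀Q : p₀ ∉ Q) (hp₀4 : p₀ % 4 = 3) (γ : ZMod 2) :
    ∃ X : ℚˣ, ((γ = 0 ∧ (X : ℚ) = 1) ∨ (γ = 1 ∧ (X : ℚ) = -(p₀ : ℚ))) ∧
      (∀ ℓ : ℕ, (hℓ : ℓ.Prime) → ℓ ≠ p₀ → haveI : Fact ℓ.Prime := ⟨hℓ⟩; parityBit ℓ (X : ℚ) = 0) ∧
      parityBit p₀ (X : ℚ) = γ ∧
      (∀ j ∈ Q, (hj : j.Prime) → haveI : Fact j.Prime := ⟨hj⟩;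
        qrBit j (X : ℚ) = γ * (if jacobiSym (-(p₀ : ℤ)) j = -1 then (1 : ZMod 2) else 0)) ∧
      qrBit p₀ (X : ℚ) = γ ∧ signBit (X : ℚ) = γ := by
  have hp0 : (p₀ : ℚ) ≠ 0 := by exact_mod_cast hp₀.out.ne_zero
  have hz2 : ∀ x : ZMod 2, x = 0 ∨ x = 1 := by decide
  rcases hz2 γ with e | e <;> subst e
  · refine ⟨1, Or.inl ⟨rfl, rfl⟩, fun ℓ hℓ _ => by simp [parityBit], by simp [parityBit], fun j hj hjp => ?_, ?_, ?_⟩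
    · haveI : Fact j.Prime := ⟨hjp⟩
      rw [Units.val_one, qrBit_one, zero_mul]
    · rw [Units.val_one, qrBit_one]
    · rw [Units.val_one]; exact (signBit_eq_zero_iff one_ne_zero).mpr one_pos
  · refine ⟨Units.mk0 _ (neg_ne_zero.mpr hp0), Or.inr ⟨rfl, rfl⟩, fun ℓ hℓ hℓp => ?_, ?_, fun j hj hjp => ?_, ?_, ?_⟩
    · haveI : Fact ℓ.Prime := ⟨hℓ⟩
      rw [Units.val_mk0, parityBit, padicValRat.neg, show (p₀ : ℚ) = ((p₀ : ℕ) : ℚ) from rfl, padicValRat.of_nat,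
        padicValNat_primes hℓp]; rfl
    · rw [Units.val_mk0, parityBit, padicValRat.neg, show (p₀ : ℚ) = ((p₀ : ℕ) : ℚ) from rfl, padicValRat.of_nat,
        padicValNat_self]; rfl
    · haveI : Fact j.Prime := ⟨hjp⟩
      rw [Units.val_mk0, one_mul, qrBit_neg_natCast_prime_eq hp₀.out (fun e => hp₀Q (e ▸ hj))]
    · rw [Units.val_mk0, show (-(p₀ : ℚ)) = (p₀ : ℚ) * (-1) by ring, qrBit_natCast_mul,
        qrBit_neg_one_eq_one_of_emod_four hp₀4]
    · rw [Units.val_mk0, signBit, if_pos]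
      exact neg_neg_of_pos (by exact_mod_cast hp₀.out.pos)

end Summit.BirchSwinnertonDyer.BirchSwinnertonDyer.Theorems.GenusKolyvaginAtTwo.TorsionCellSEL

end
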